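import Summits.ResolutionOfSingularities.ResolutionOfSingularities.Theorems.FrobeniusClosingSteerBinaryResidueOddSatellite
import Summits.ResolutionOfSingularities.ResolutionOfSingularities.Theorems.FrobeniusClosingSteerBinaryResidueWindowKernelOddSquares
import HarnessLib

/-!
# hARᵒ H2 — Fβ: **the same exceptional parameter at two consecutive visits forces the cleaned order to DROP at the third**
# (three-member contradiction lemma, RATIONAL adapted windows; characteristic `2`; Theses-free, def-free)

OURS (campaign `res-hironaka`, rung L ★L-G4, slot W4.1 · crux `Steer` (stmt-ResolutionOfSingularities-16345) · hARᵒ H2 programme, P0 FILE 2 of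
res-L0-w41-plan-1's `P0-BRIEF-hARo.md` b66a17a38113b83f / RULINGS 214(b), 221(b); design res-type-062 `H2-DESIGN.md` 7dac75913b6b98e3 §5 (Fβ);
seat res-D-lib-2 g10). Over F1 `BinaryResidue.mem_sup_of_window` (p545669), F1′ `BinaryResidue.exists_sub_mul_sq_mem_pow_of_window` (p553654),
the parity lemma `exists_sub_mul_sq_mem_pow_of_mul_sub_sq_mem_pow` (p546632) and F3's window plumbing (`…BinaryResidueOddSatellite`, p547879).
Not a statement of the manuscript under review [claim: Hironaka2017, status: under-review]; AI-produced, weaker than expert review.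

THE SETTING (three consecutive members `S₀ ≤ S₁ ≤ S₂ ⊆ L` of the run: an A-stage, the visit `B₁` after it, the visit `B₂` after that; both point
windows ADAPTED and RATIONAL, and — the hypothesis Fβ refutes — with THE SAME exceptional parameter `x`). Window 1: `𝔪_{S₀} = (x, u₁, u₂, u₃)`,
`𝔪_{S₁} = (x, u')`, `u_j = x·u'_j`. Window 2: `𝔪_{S₁} = (x, v₁, v₂, v₃)`, `𝔪_{S₂} = (x, v')`, `v_j = x·v'_j` (`x` exceptional AGAIN at `B₁`). Radicands:
`f₀ − G₀² ∈ 𝔪_{S₀}^d` and `f₀ − g² ∉ 𝔪_{S₀}^(d+1)` for all `g` (cleaned order EXACTLY `d` at the A-stage, `d + 1 = 2e` odd), the squared visit laws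
`f₁·x^(d−1)·W² = f₀ − G²` (`G, W ∈ S₁`) and `f₂·x^(d+1)·W₁² = f₁ − G₁²` (`G₁, W₁ ∈ S₂`), cleaned order `≥ d + 1` at `S₁` AND at `S₂`.

* **`false_of_exceptional_twice`** — THE THEOREM: the setting is contradictory. Chain (H2-DESIGN §5 (Fβ)): STRUCTURE `W²f₁ = x·h̃ + Δ′²`
  (`h̃ = (f₀ − G₀²)/x^d`) → PARITY `h̃′ := h̃ − x·q² ∈ 𝔪_{S₁}^d` → member at `S₂`: `W²W₁²x^(d+1)f₂ = x^(d+1)·h″ + ρ²`, `h″ = h̃′/x^d`, `ρ = ρ′·x^e`, so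
  `h″ ≡ (W W₁ γ₂ + ρ′)² (mod 𝔪_{S₂}^(d+1))` → F1′ with no letters at window 2: `h̃′ − x·G′² ∈ 𝔪_{S₁}^(d+1)` → `h̃ = x·(G′ + q)² + (h̃′ − x·G′²) ∈
  (x) + 𝔪_{S₁}^(d+1)` → F1 with no letters at window 1: `f₀ − G₀² ∈ 𝔪_{S₀}^(d+1)` ↯. COROLLARY for the run (typing downstream, Fβʳᵘⁿ): along a
  stretch of visits where `x` stays exceptional the visits alternate A B A B ….
[cite: Matsumura1987, Thm. 14.2, Thm. 17.10] [folklore]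
-/

noncomputable section

-- `Summit.<S>.<S>.…` duplicates the summit name by design (single-problem summit).
set_option linter.dupNamespace false

open IsLocalRing MvPolynomial

namespace Summit.ResolutionOfSingularities.ResolutionOfSingularities.Theorems.SwitchingDichotomy.BinaryResidue

open Literature.AlgebraicGeometry.Resolution

section assembly

variable {L : Type} [Field L]

/-- **The same exceptional parameter at two consecutive visits is contradictory when the cleaned order does not drop.** See the module
docstring for the setting and the chain. [cite: Matsumura1987, Thm. 14.2, Thm. 17.10] [folklore] -/
theorem false_of_exceptional_twice (h2 : (2 : L) = 0) (S₀ S₁ S₂ : Subring L) [IsLocalRing S₀] [IsLocalRing S₁] [IsLocalRing S₂]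
    (h01 : S₀ ≤ S₁) (h12 : S₁ ≤ S₂) (hreg₁ : IsRegularLocalRing S₁) (hreg₂ : IsRegularLocalRing S₂)
    (hdim₁ : ringKrullDim S₁ = (4 : ℕ)) (hdim₂ : ringKrullDim S₂ = (4 : ℕ))
    -- window 1 (A-stage → B₁), exceptional parameter `x`
    (x : S₀) (hx0 : (x : L) ≠ 0) (u : Fin 3 → S₀) (hxu : Ideal.span (insert x (Set.range u)) = maximalIdeal S₀)
    (u' : Fin 3 → S₁) (hu : ∀ j, ((u j : S₀) : L) = (x : L) * ((u' j : S₁) : L))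
    (hm₁ : Ideal.span (insert (⟨(x : L), h01 x.2⟩ : S₁) (Set.range u')) = maximalIdeal S₁)
    (hrat₁ : ∀ a : S₁, ∃ b : S₀, a - ⟨(b : L), h01 b.2⟩ ∈ maximalIdeal S₁)
    -- window 2 (B₁ → B₂), exceptional parameter `x` AGAIN
    (v : Fin 3 → S₁) (hxv : Ideal.span (insert (⟨(x : L), h01 x.2⟩ : S₁) (Set.range v)) = maximalIdeal S₁)
    (v' : Fin 3 → S₂) (hv : ∀ j, ((v j : S₁) : L) = (x : L) * ((v' j : S₂) : L))
    (hm₂ : Ideal.span (insert (⟨(x : L), h12 (h01 x.2)⟩ : S₂) (Set.range v')) = maximalIdeal S₂)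
    (hrat₂ : ∀ a : S₂, ∃ b : S₁, a - ⟨(b : L), h12 b.2⟩ ∈ maximalIdeal S₂)
    -- radicands
    {d e : ℕ} (hde : d + 1 = 2 * e) (f₀ G₀ : S₀) (hG₀ : f₀ - G₀ ^ 2 ∈ maximalIdeal S₀ ^ d)
    (hexact₀ : ∀ g : S₀, f₀ - g ^ 2 ∉ maximalIdeal S₀ ^ (d + 1))
    (f₁ G W : S₁) (hlaw₁ : ((f₁ : S₁) : L) * (x : L) ^ (d - 1) * ((W : S₁) : L) ^ 2 = ((f₀ : S₀) : L) - ((G : S₁) : L) ^ 2)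
    (hclean₁ : ∃ γ₁ : S₁, f₁ - γ₁ ^ 2 ∈ maximalIdeal S₁ ^ (d + 1))
    (f₂ G₁ W₁ : S₂) (hlaw₂ : ((f₂ : S₂) : L) * (x : L) ^ (d + 1) * ((W₁ : S₂) : L) ^ 2 = ((f₁ : S₁) : L) - ((G₁ : S₂) : L) ^ 2)
    (hclean₂ : ∃ γ₂ : S₂, f₂ - γ₂ ^ 2 ∈ maximalIdeal S₂ ^ (d + 1)) : False := by
  classical
  haveI := hreg₁; haveI := hreg₂
  haveI := isDomain_of_isRegularLocalRing S₁
  haveI := isDomain_of_isRegularLocalRing S₂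
  have he : 1 ≤ e := by omega
  have hd1 : d - 1 = 2 * (e - 1) := by omega
  have hde' : d = 2 * (e - 1) + 1 := by omega
  have hd0 : d ≠ 0 := by omega
  -- characteristic 2 in the members
  have h2S₁ : (2 : S₁) = 0 := Subtype.ext (by change S₁.subtype 2 = S₁.subtype 0; rw [map_ofNat, map_zero]; exact h2)
  have h2S₂ : (2 : S₂) = 0 := Subtype.ext (by change S₂.subtype 2 = S₂.subtype 0; rw [map_ofNat, map_zero]; exact h2)
  -- the regular systems as `Fin 4`-families
  have hsfr : ∀ (S : Subring L) [IsRegularLocalRing S], ringKrullDim S = (4 : ℕ) → (maximalIdeal S).spanFinrank = 4 := by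
    intro S _ hdim
    have h := IsRegularLocalRing.spanFinrank_maximalIdeal (R := S)
    rw [hdim] at h
    exact_mod_cast h
  set xS₁ : S₁ := ⟨(x : L), h01 x.2⟩ with hxS₁
  set xS₂ : S₂ := ⟨(x : L), h12 (h01 x.2)⟩ with hxS₂
  set z₁ : Fin 4 → S₁ := Fin.cons xS₁ v with hz₁
  have hz₁span : Ideal.span (Set.range z₁) = maximalIdeal S₁ := by rw [hz₁, Fin.range_cons, hxv]
  set z₂ : Fin 4 → S₂ := Fin.cons xS₂ v' with hz₂
  have hz₂span : Ideal.span (Set.range z₂) = maximalIdeal S₂ := by rw [hz₂, Fin.range_cons, hm₂]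
  -- `x ∈ 𝔪 ∖ 𝔪²`, prime, in `S₁` and in `S₂`
  have hxm₁ : xS₁ ∈ maximalIdeal S₁ := by rw [← hxv]; exact Ideal.subset_span (Set.mem_insert _ _)
  have hx2₁ : xS₁ ∉ maximalIdeal S₁ ^ 2 := not_mem_sq_of_span_eq (hsfr S₁ hdim₁) z₁ hz₁span 0
  have hxS₁0 : xS₁ ≠ 0 := fun h => hx0 (congrArg Subtype.val h)
  have hxprime : Prime xS₁ :=
    (Ideal.span_singleton_prime hxS₁0).mp (SigmaTopLegality.isPrime_span_singleton_of_not_mem_sq S₁ hxm₁ hx2₁)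
  have hxm₂ : xS₂ ∈ maximalIdeal S₂ := by rw [← hm₂]; exact Ideal.subset_span (Set.mem_insert _ _)
  have hx2₂ : xS₂ ∉ maximalIdeal S₂ ^ 2 := not_mem_sq_of_span_eq (hsfr S₂ hdim₂) z₂ hz₂span 0
  have hxS₂0 : xS₂ ≠ 0 := fun h => hx0 (congrArg Subtype.val h)
  have hxprime₂ : Prime xS₂ :=
    (Ideal.span_singleton_prime hxS₂0).mp (SigmaTopLegality.isPrime_span_singleton_of_not_mem_sq S₂ hxm₂ hx2₂)
  -- (a) STRUCTURE: the weak transform `h̃ = (f₀ − G₀²)/x^d ∈ S₁` and `W²·f₁ = x·h̃ + Δ²`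
  obtain ⟨ht, hht⟩ := exists_mul_pow_eq_of_mem_pow h01 x u hxu u' hu hG₀
  set G₀S₁ : S₁ := ⟨(G₀ : L), h01 G₀.2⟩ with hG₀S₁
  have hxL : ((xS₁ : S₁) : L) = (x : L) := rfl
  have hGL : ((G₀S₁ : S₁) : L) = (G₀ : L) := rfl
  have hsq : (G₀S₁ - G) ^ 2 = xS₁ ^ (d - 1) * (W ^ 2 * f₁ - xS₁ * ht) := by
    apply Subtype.ext
    push_cast
    rw [hxL, hGL]
    have e1 : (x : L) ^ d = (x : L) ^ (d - 1) * (x : L) := by rw [← pow_succ, show d - 1 + 1 = d by omega]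
    have hhtd : ((ht : S₁) : L) * ((x : L) ^ (d - 1) * (x : L)) = ((f₀ : S₀) : L) - ((G₀ : S₀) : L) ^ 2 := by
      rw [← e1, hht]; push_cast; ring
    linear_combination (-1 : L) * hlaw₁ + (1 : L) * hhtd +
      (((G : S₁) : L) * (((G : S₁) : L) - ((G₀ : S₀) : L))) * h2
  have hsq' : (G₀S₁ - G) ^ 2 = xS₁ ^ (2 * (e - 1)) * (W ^ 2 * f₁ - xS₁ * ht) := by rw [← hd1]; exact hsq
  obtain ⟨Δ, hΔ⟩ := pow_dvd_of_pow_two_mul_dvd_sq hxprime (e - 1) (a := G₀S₁ - G) ⟨_, hsq'⟩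
  have hstruct : W ^ 2 * f₁ = xS₁ * ht + Δ ^ 2 := by
    have hne : xS₁ ^ (2 * (e - 1)) ≠ 0 := pow_ne_zero _ hxS₁0
    have h3 : xS₁ ^ (2 * (e - 1)) * (W ^ 2 * f₁ - xS₁ * ht) = xS₁ ^ (2 * (e - 1)) * Δ ^ 2 := by
      rw [← hsq', hΔ]; ring
    have h4 := mul_left_cancel₀ hne h3
    linear_combination h4
  -- (b) PARITY: `x·h̃ − (W γ₁ + Δ)² ∈ 𝔪^(d+1)` ⇒ `h̃′ := h̃ − x q² ∈ 𝔪^d`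
  obtain ⟨γ₁, hγ₁⟩ := hclean₁
  have hrel : xS₁ * ht - (W * γ₁ + Δ) ^ 2 ∈ maximalIdeal S₁ ^ (2 * e) := by
    have : xS₁ * ht - (W * γ₁ + Δ) ^ 2 = W ^ 2 * (f₁ - γ₁ ^ 2) := by
      linear_combination (-1 : S₁) * hstruct + (-(W * γ₁ * Δ) - Δ ^ 2) * h2S₁
    rw [this, ← hde]
    exact Ideal.mul_mem_left _ _ hγ₁
  obtain ⟨q, hq⟩ := exists_sub_mul_sq_mem_pow_of_mul_sub_sq_mem_pow h2S₁ hxm₁ hx2₁ he hrel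
  rw [show 2 * e - 1 = d by omega] at hq
  set ht' : S₁ := ht - xS₁ * q ^ 2 with hht'
  -- (c) the weak transform `h″ = h̃′/x^d ∈ S₂` across window 2 and the member `W²W₁²x^(d+1)f₂ = x^(d+1)·h″ + ρ²`
  obtain ⟨ht'', hht''⟩ := exists_mul_pow_eq_of_mem_pow h12 xS₁ v hxv v' hv hq
  set WS₂ : S₂ := ⟨(W : L), h12 W.2⟩ with hWS₂
  have hWL : ((WS₂ : S₂) : L) = (W : L) := rfl
  have hx₂L : ((xS₂ : S₂) : L) = (x : L) := rfl
  have h02 : S₀ ≤ S₂ := h01.trans h12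
  set ρ : S₂ := ⟨(x : L) * ((q : S₁) : L) + ((Δ : S₁) : L) + ((W : S₁) : L) * ((G₁ : S₂) : L),
    S₂.add_mem (S₂.add_mem (S₂.mul_mem (h02 x.2) (h12 q.2)) (h12 Δ.2)) (S₂.mul_mem (h12 W.2) G₁.2)⟩ with hρ
  have hρL : ((ρ : S₂) : L) = (x : L) * ((q : S₁) : L) + ((Δ : S₁) : L) + ((W : S₁) : L) * ((G₁ : S₂) : L) := rfl
  have hht'L : ((ht' : S₁) : L) = ((ht : S₁) : L) - (x : L) * ((q : S₁) : L) ^ 2 := by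
    rw [hht']; push_cast; rw [hxL]
  have hmem₂ : WS₂ ^ 2 * W₁ ^ 2 * xS₂ ^ (d + 1) * f₂ = xS₂ * (ht'' * xS₂ ^ d) + ρ ^ 2 := by
    apply Subtype.ext
    push_cast
    rw [hWL, hx₂L, hρL, hht'', hht'L]
    have hstructL : ((W : S₁) : L) ^ 2 * ((f₁ : S₁) : L) = (x : L) * ((ht : S₁) : L) + ((Δ : S₁) : L) ^ 2 := by
      have := congrArg Subtype.val hstruct
      push_cast at this
      rw [hxL] at this
      exact this
    linear_combination (((W : S₁) : L) ^ 2) * hlaw₂ + hstructL -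
      (((W : S₁) : L) ^ 2 * ((G₁ : S₂) : L) ^ 2 + (x : L) * ((q : S₁) : L) * ((Δ : S₁) : L) +
        (x : L) * ((q : S₁) : L) * ((W : S₁) : L) * ((G₁ : S₂) : L) + ((Δ : S₁) : L) * ((W : S₁) : L) * ((G₁ : S₂) : L)) * h2
  -- `ρ = ρ′ · x^e`
  obtain ⟨ρ', hρ'⟩ := pow_dvd_of_pow_two_mul_dvd_sq hxprime₂ e (a := ρ) (by
    refine ⟨WS₂ ^ 2 * W₁ ^ 2 * f₂ - ht'', ?_⟩
    rw [← hde]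
    linear_combination (-1 : S₂) * hmem₂)
  -- (d) `h″ ≡ (W W₁ γ₂ + ρ′)² (mod 𝔪_{S₂}^(d+1))`
  obtain ⟨γ₂, hγ₂⟩ := hclean₂
  have hyp₂ : ht'' - (WS₂ * W₁ * γ₂ + ρ') ^ 2 ∈ maximalIdeal S₂ ^ (d + 1) ⊔ Ideal.span {xS₂} := by
    refine Ideal.mem_sup_left ?_
    have hne : xS₂ ^ (d + 1) ≠ 0 := pow_ne_zero _ hxS₂0
    have key : xS₂ ^ (d + 1) * (ht'' - (WS₂ * W₁ * γ₂ + ρ') ^ 2) =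
        xS₂ ^ (d + 1) * (WS₂ ^ 2 * W₁ ^ 2 * (f₂ - γ₂ ^ 2)) := by
      have eρ : ρ ^ 2 = xS₂ ^ (d + 1) * ρ' ^ 2 := by rw [hρ', hde]; ring
      linear_combination (-1 : S₂) * hmem₂ + (-1 : S₂) * eρ -
        (xS₂ ^ (d + 1) * WS₂ * W₁ * γ₂ * ρ' + xS₂ ^ (d + 1) * ρ' ^ 2) * h2S₂
    rw [mul_left_cancel₀ hne key]
    exact Ideal.mul_mem_left _ _ hγ₂
  -- (e) F1′ with no letters at window 2: `h̃′ − x·G′² ∈ 𝔪_{S₁}^(d+1)`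
  have hdim₂' : ringKrullDim S₂ = ((3 : ℕ) + 1 : ℕ) := by rw [hdim₂]
  obtain ⟨G', hG'⟩ := exists_sub_mul_sq_mem_pow_of_window h2 S₁ S₂ h12 hreg₂ hdim₂' xS₁ hx0 v hxv v' hv hm₂ hrat₂ hde'
    ht' ht'' hht'' hq (WS₂ * W₁ * γ₂ + ρ') hyp₂
  -- (f) `h̃ = x·(G′ + q)² + (h̃′ − x·G′²) ∈ (x) + 𝔪_{S₁}^(d+1)`: F1 with no letters at window 1
  have hdim₁' : ringKrullDim S₁ = ((3 : ℕ) + 1 : ℕ) := by rw [hdim₁]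
  set σ' : Fin 0 → S₁ := Fin.elim0 with hσ'
  have hinput : ht ∈ Ideal.span (Set.range σ') ^ d ⊔ maximalIdeal S₁ ^ (d + 1) ⊔ Ideal.span {xS₁} := by
    have e1 : ht = (ht' - xS₁ * G' ^ 2) + xS₁ * (G' + q) ^ 2 := by
      rw [hht']
      linear_combination (-(xS₁ * G' * q)) * h2S₁
    rw [e1]
    exact add_mem (Ideal.mem_sup_left (Ideal.mem_sup_right hG'))
      (Ideal.mem_sup_right (Ideal.mul_mem_right _ _ (Ideal.mem_span_singleton_self _)))
  obtain ⟨a, -, hmem⟩ := mem_sup_of_window S₀ S₁ h01 hreg₁ hdim₁' x hx0 u hxu u' hu hm₁ hrat₁ (f₀ - G₀ ^ 2) ht hht hG₀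
    σ' (fun k => k.elim0) hinput
  have h0 : Ideal.span (Set.range fun k : Fin 0 => ∑ j, a k j * u j) ^ d ≤ maximalIdeal S₀ ^ (d + 1) := by
    rw [Set.range_eq_empty, Ideal.span_empty, ← Ideal.zero_eq_bot, zero_pow hd0]
    exact bot_le
  exact hexact₀ G₀ (sup_le h0 le_rfl hmem)

end assembly

end Summit.ResolutionOfSingularities.ResolutionOfSingularities.Theorems.SwitchingDichotomy.BinaryResidue

end
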